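import Summits.Parity.GeneralizedHardyLittlewood.Theorems.PrimeLevelFamEdgeMomentsBeyondDiagonalDiagRemBothSidedMoments
import Summits.Parity.GeneralizedHardyLittlewood.Theorems.PrimeLevelFamEdgeMomentsBeyondDiagonalDiagRemLogSavingPow
import Summits.Parity.GeneralizedHardyLittlewood.Theorems.PrimeLevelFamEdgeMomentsBeyondDiagonalDiagCornerProfileSum
import HarnessLib

/-!
# Route `PrimeLevelFamEdge`, crux K_A `MomentsBeyondDiagonal` (stmt-Parity-20007), line «petersson_layers» v4, stub `stub_diag`:
# **the GENERIC one-sided moment monomial `a_n ⊗ (W_nS_s) · R`, every `s`** (the decorated-column families `Ψ₂, Ψ₄, Ψ₆, Ψ₈, …` of every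
# order's remainder weight, once; no pointwise kernel bound needed)

Companion of `…DiagRemBothSidedMoments.abs_bothsided_moments_le_pow`. For the one-sided monomials the row `a_n = copTauW n` has partial
sums `→ 0` with a power-of-log rate (`…DiagRemLogSavingPow.abs_sum_copTauW_le_pow`), so no δ-subtraction is needed: ONE application of the
two-sequence estimate `hR2` with `a₁ = a_n` (tail) and `a₂ = W_nS_s` (column, bounded by «DRTAIL»_s of `…DiagRemMomentTailBoundPow` —
`≤ 2C_sD(n)`, no log loss). Hence the lemma holds for EVERY kernel with the two-sequence estimate, including those without pointwise bounds
(`r_ab` with `a + b > 4` at order `(4,4)`).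

* `abs_onesided_moments_le_pow` — **for all `s A`: constants `C_a > 0`, `C₂ ≥ 0` with, for every `n ≥ 1`,
  `|Σ_{k₁,k₂≤Y} a_n(k₁)(W_nS_s)(k₂)ℓ⁺ⁱℓ⁺ʲR(αk₁k₂)| ≤ log^{i+j}Y·C₀·(6C₂D(1+log Y)²·√(2αK₁Y) + 18(1+log Y)^{s+2}C_aD·xᴺ/(1+log K₁)ᴬ)`.**

Def-free; theorems only. Helper `--supports stmt-Parity-20007`; closes nothing; K_A, K_B and the Parity summit are NOT proved;
nothing about Landau–Siegel zeros.

## References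
* E. Kowalski, P. Michel, J. VanderKam, J. reine angew. Math. 526 (2000), Prop. 5.1 p. 18.
  [cite: KowalskiMichelVanderKam2000, Prop. 5.1 — derivation (one-sided decorated remainder monomials, any order)]
-/

noncomputable section

open Real Finset

namespace Summit.Parity.GeneralizedHardyLittlewood.Theorems.MomentsBeyondDiagonal.DiagCorner

open Literature.NumberTheory.LFunctions.KMV2000.MollifierMainTerm (W)
open Summit.Parity.GeneralizedHardyLittlewood.Theorems.BeyondDiagonalBeatsQuarter.KernelFormXSq
  (copTauW divWeight divWeight_nonneg)
open Summit.Parity.GeneralizedHardyLittlewood.Theorems.BeyondDiagonalBeatsQuarter.Corner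

set_option maxHeartbeats 1600000 in
/-- **The generic one-sided moment monomial `a_n ⊗ (W_nS_s) · R`** (see the module docstring), for an abstract kernel with the two-sequence
estimate only (saving exponent `A`, envelope exponent `N`).
[cite: KowalskiMichelVanderKam2000, Prop. 5.1 — derivation (one-sided decorated remainder monomial)] -/
theorem abs_onesided_moments_le_pow (s A N : ℕ) {R : ℝ → ℝ} {C₀ : ℝ} (hC₀ : 0 ≤ C₀)
    (hR2 : ∀ (a₁ a₂ : ℕ → ℝ) (Y α B η : ℝ) (K₁ i j : ℕ), 1 ≤ Y → 0 < α → 1 ≤ i → 1 ≤ j →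
      (∀ e : ℕ, e ≤ ⌊Y⌋₊ → |∑ k ∈ Icc 1 e, a₂ k| ≤ B) → (∀ e : ℕ, K₁ ≤ e → |∑ k ∈ Icc 1 e, a₁ k| ≤ η) →
      2 * α * K₁ * Y ≤ 1 →
    |∑ k₁ ∈ Icc 1 ⌊Y⌋₊, ∑ k₂ ∈ Icc 1 ⌊Y⌋₊,
        a₁ k₁ * a₂ k₂ * ellp Y k₁ ^ i * ellp Y k₂ ^ j * R (α * k₁ * k₂)| ≤
      (∑ k ∈ Icc 1 ⌊Y⌋₊, |a₁ k| * ellp Y k ^ i) * (B * (Real.log Y ^ j * (3 * C₀ * Real.sqrt (2 * α * K₁ * Y)))) +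
        (∑ k ∈ Icc 1 ⌊Y⌋₊, |a₂ k| * ellp Y k ^ j) *
          ((2 * η) * (Real.log Y ^ i * (9 * C₀ * (1 + |Real.log (2 * α * Y ^ 2)|) ^ N)))) :
    ∃ Ca C₂ : ℝ, 0 < Ca ∧ 0 ≤ C₂ ∧
    (∀ n : ℕ, n ≠ 0 → ∀ (Y α : ℝ) (K₁ i j : ℕ), 1 ≤ Y → 0 < α → 1 ≤ i → 1 ≤ j → 2 * α * K₁ * Y ≤ 1 →
    |∑ k₁ ∈ Icc 1 ⌊Y⌋₊, ∑ k₂ ∈ Icc 1 ⌊Y⌋₊,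
        copTauW n k₁ *
          ((if k₂.Coprime n then W k₂ else 0) * ∑ x ∈ k₂.divisorsAntidiagonal, (Real.log x.1 - Real.log x.2) ^ s) *
            ellp Y k₁ ^ i * ellp Y k₂ ^ j * R (α * k₁ * k₂)| ≤
      Real.log Y ^ (i + j) * (C₀ *
        (6 * (C₂ * divWeight n) * (1 + Real.log Y) ^ 2 * Real.sqrt (2 * α * K₁ * Y) +
          18 * (1 + Real.log Y) ^ (s + 2) * (Ca * divWeight n) *
            (1 + |Real.log (2 * α * Y ^ 2)|) ^ N / (1 + Real.log K₁) ^ A))) := by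
  obtain ⟨Ca, hCa, ha⟩ := abs_sum_copTauW_le_pow A
  obtain ⟨C₂, hC₂, h₂⟩ := abs_sum_Wn_logDiff_pow_sub_le_pow s A
  refine ⟨Ca, C₂, hCa, hC₂, fun n hn Y α K₁ i j hY hα hi hj hY₁ ↦ ?_⟩
  obtain ⟨c₂, hc₂, hc₂y⟩ := h₂ n hn
  set D : ℝ := divWeight n with hDdef
  have hD0 : 0 ≤ D := divWeight_nonneg n
  have hY0 : 0 < Y := by linarith
  have hLY : 0 ≤ Real.log Y := Real.log_nonneg hY
  have hK0 : 0 ≤ Real.log (K₁ : ℝ) := Real.log_natCast_nonneg K₁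
  set KA : ℝ := (1 + Real.log K₁) ^ A with hKA
  have hKA0 : 0 < KA := by positivity
  set b₂ : ℕ → ℝ := fun k ↦ (if k.Coprime n then W k else 0) *
    ∑ x ∈ k.divisorsAntidiagonal, (Real.log x.1 - Real.log x.2) ^ s with hb₂
  -- tail of the row `a_n` beyond `K₁`
  have hat : ∀ e : ℕ, K₁ ≤ e → |∑ k ∈ Icc 1 e, copTauW n k| ≤ Ca * D / KA := by
    intro e he
    rcases Nat.eq_zero_or_pos e with rfl | he0
    · simp only [show Icc (1 : ℕ) 0 = ∅ from Finset.Icc_eq_empty (by norm_num), Finset.sum_empty, abs_zero]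
      positivity
    · have h := ha n hn (e : ℝ) (by exact_mod_cast he0)
      rw [Nat.floor_natCast] at h
      refine h.trans ?_
      apply div_le_div_of_nonneg_left (by positivity) hKA0
      have hle : Real.log (K₁ : ℝ) ≤ Real.log (e : ℝ) := by
        rcases Nat.eq_zero_or_pos K₁ with rfl | hK
        · simp only [Nat.cast_zero, Real.log_zero]; exact Real.log_natCast_nonneg e
        · exact Real.log_le_log (by exact_mod_cast hK) (by exact_mod_cast he)
      exact pow_le_pow_left₀ (by positivity) (by linarith) A
  -- column bound of `b₂` from «DRTAIL»
  have hbcol₂ : ∀ e : ℕ, e ≤ ⌊Y⌋₊ → |∑ k ∈ Icc 1 e, b₂ k| ≤ 2 * (C₂ * D) := by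
    intro e _
    rcases Nat.eq_zero_or_pos e with rfl | he0
    · simp only [show Icc (1 : ℕ) 0 = ∅ from Finset.Icc_eq_empty (by norm_num), Finset.sum_empty, abs_zero]
      positivity
    · have h := hc₂y (e : ℝ) (by exact_mod_cast he0)
      rw [Nat.floor_natCast] at h
      have hle : C₂ * D / (1 + Real.log (e : ℝ)) ^ A ≤ C₂ * D :=
        div_le_self (by positivity) (one_le_pow₀ (by linarith [Real.log_natCast_nonneg e]))
      have : |∑ k ∈ Icc 1 e, b₂ k| ≤ |(∑ k ∈ Icc 1 e, b₂ k) - c₂| + |c₂| := by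
        have := abs_add_le ((∑ k ∈ Icc 1 e, b₂ k) - c₂) c₂; simpa using this
      linarith
  have hmain := hR2 (fun k ↦ copTauW n k) b₂ Y α (2 * (C₂ * D)) (Ca * D / KA) K₁ i j hY hα hi hj hbcol₂ hat hY₁
  refine hmain.trans ?_
  have hSa : ∑ k ∈ Icc 1 ⌊Y⌋₊, |copTauW n k| * ellp Y k ^ i ≤ Real.log Y ^ i * (1 + Real.log Y) ^ 2 :=
    sum_abs_copTauW_mul_ellp_pow_le n i hY
  have hSb : ∑ k ∈ Icc 1 ⌊Y⌋₊, |b₂ k| * ellp Y k ^ j ≤ Real.log Y ^ j * (1 + Real.log Y) ^ (s + 2) :=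
    sum_abs_Wn_logDiff_pow_ellp_pow_le n s j hY
  set sq : ℝ := Real.sqrt (2 * α * K₁ * Y) with hsq
  set x : ℝ := 1 + |Real.log (2 * α * Y ^ 2)| with hx
  have t1 : (∑ k ∈ Icc 1 ⌊Y⌋₊, |copTauW n k| * ellp Y k ^ i) * ((2 * (C₂ * D)) * (Real.log Y ^ j * (3 * C₀ * sq))) ≤
      Real.log Y ^ (i + j) * (C₀ * (6 * (C₂ * D) * (1 + Real.log Y) ^ 2 * sq)) := by
    have hX : 0 ≤ (2 * (C₂ * D)) * (Real.log Y ^ j * (3 * C₀ * sq)) := by positivity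
    calc _ ≤ (Real.log Y ^ i * (1 + Real.log Y) ^ 2) * ((2 * (C₂ * D)) * (Real.log Y ^ j * (3 * C₀ * sq))) :=
          mul_le_mul_of_nonneg_right hSa hX
      _ = _ := by rw [pow_add]; ring
  have t2 : (∑ k ∈ Icc 1 ⌊Y⌋₊, |b₂ k| * ellp Y k ^ j) * ((2 * (Ca * D / KA)) * (Real.log Y ^ i * (9 * C₀ * x ^ N))) ≤
      Real.log Y ^ (i + j) * (C₀ * (18 * (1 + Real.log Y) ^ (s + 2) * (Ca * D) * x ^ N / KA)) := by
    have hX : 0 ≤ (2 * (Ca * D / KA)) * (Real.log Y ^ i * (9 * C₀ * x ^ N)) := by positivity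
    calc _ ≤ (Real.log Y ^ j * (1 + Real.log Y) ^ (s + 2)) * ((2 * (Ca * D / KA)) * (Real.log Y ^ i * (9 * C₀ * x ^ N))) :=
          mul_le_mul_of_nonneg_right hSb hX
      _ = _ := by rw [pow_add]; field_simp; ring
  refine (add_le_add t1 t2).trans (le_of_eq ?_)
  rw [mul_div_assoc]
  ring

end Summit.Parity.GeneralizedHardyLittlewood.Theorems.MomentsBeyondDiagonal.DiagCorner

end
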